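import Summits.QuantumFields.YangMills.Theorems.DiagonalMirrorRPRWilsonDiagonalModelObservableChain
import Summits.QuantumFields.YangMills.Theorems.DiagonalMirrorRPRWilsonDiagonalModelProductMarginals

/-!
# Crux `WeakCouplingHypercubicLimitRP` (stmt-QuantumFields-27398) / aside `DiagonalMirrorRPR` (stmt-QuantumFields-10604), door B,
# construction F1_diag — PAIRING LAYER, step P3c: the BLOCK FACTORISATION of the reflected two-point insertion

Helper file (`--supports stmt-QuantumFields-27398 --as helper`) of the hand `hand-10604-wilsonDiagModel-2` (docket director-ym O4 WORD 16 (1) /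
28, step P3 of hand-1's ROADMAP-F1diag v4 §1⅞); it closes nothing by itself.

WHAT.  On a pair chain of length `m = n + 2d` (`d = e + 1`) carrying an observable `f` of depth `d` read on the layers `1 … d` (`obsR f`) and its
swap reflection read on the layers `0, -1, …, 1-d` (`obsL f`), the bond half layers split into three independent groups under the product Haar
measure: the `d` layers of `f`, the `d` layers of `Θf`, and the `n` free layers `d+1, …, d+n`.  After `…ObservableChain` (all even steps
feature-expanded, lifted sites `V_t = (k_t, X_t)` with the finite measure `μ̃`), the bond-layer integral FACTORISES (`…ProductMarginals`):
the free group gives the `n` reweighted lifted kernels `𝔟(V_{t-1}, V_t)`, `t = d+1 … d+n`; the group of `f` gives the half block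
`halfBlock f (V_0, V_1, …, V_d)`; the group of `Θf`, after the measure-preserving substitution `Y ↦ ΘY` and the reversal
`openLink(a,b)(ΘY) = openLink(b,a)(Y)`, gives the SAME half block on the reflected sites `halfBlock f (V_0, V_{-1}, …, V_{-d})`:
* §1 index bookkeeping on `ℤ/mℤ` (the three groups are disjoint and exhaust the cycle);
* §2 ★★ **`integral_obsLR_mul_pairChain_eq`**:
  `∫ Θf(P) f(P) ∏_t e^{β even_t} e^{β odd_t} dP = ∫ (∏_{j<n} 𝔟(V_{d+j}, V_{d+1+j})) · halfBlock f (V_{-·}) · halfBlock f (V_{·}) dμ̃^{⊗ℤ/mℤ}(V)`.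
This is reflection positivity of the transfer-matrix representation at the level of kernels (Osterwalder–Seiler): the two half blocks are the
same function of mirror-image site data and meet at the reflection layer `V_0`.

HONEST FRAMING: bookkeeping of the pairing layer; `wilsonDiagonalModel` is NOT landed here; no letter is proved; D1, ⟨27398⟩, S6i and the aside
⟨10604⟩ are OPEN; nothing here bears on the summit; the Yang–Mills mass gap is NOT proved here or anywhere in the tree.  No definition, no
instance, no notation, `autoImplicit false`.

References: K. Osterwalder, E. Seiler, Ann. Phys. 110 (1978) §2–3; E. Seiler, LNP 159 (1982) Ch. 2.
-/

set_option autoImplicit false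

noncomputable section

open scoped BigOperators ENNReal
open MeasureTheory Function
open Literature.MathematicalPhysics.QuantumLattice Literature.MathematicalPhysics.QuantumFieldTheory
open Summit.QuantumFields.YangMills.Cruxes.DiagonalMirrorRPR.ParityBridgeColdTraces

namespace Summit.QuantumFields.YangMills.Cruxes.DiagonalMirrorRPR.SignTwistedDiagonalTrace.WilsonDiagonal

/-! ## §1 Index bookkeeping: the three groups of bond half layers on `ℤ/mℤ`, `m = n + 2e + 2` -/

section Index

variable {m : ℕ}

/-- Casting `ℕ → ℤ/mℤ` is injective below `m`. -/
theorem natCast_zmod_injOn {a b : ℕ} (ha : a < m) (hb : b < m) (h : (a : ZMod m) = (b : ZMod m)) : a = b := by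
  rw [ZMod.natCast_eq_natCast_iff', Nat.mod_eq_of_lt ha, Nat.mod_eq_of_lt hb] at h
  exact h

/-- A positive natural below `m` is non-zero in `ℤ/mℤ`. -/
theorem natCast_zmod_ne_zero {a : ℕ} (h0 : 0 < a) (ha : a < m) : (a : ZMod m) ≠ 0 := by
  intro h
  rw [ZMod.natCast_eq_zero_iff] at h
  exact absurd (Nat.eq_zero_of_dvd_of_lt h ha) h0.ne'

/-- The three groups of bond layers — free `d+1 … d+n`, reflected `0, -1, …, -e`, direct `1 … d` (`d = e+1`) — as one map from the sum type. -/
theorem bondGroups_injective {n e : ℕ} (hm : m = n + 2 * e + 2) :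
    Function.Injective (Sum.elim (fun j : Fin n => ((e + 2 + (j : ℕ) : ℕ) : ZMod m))
      (Sum.elim (fun i : Fin (e + 1) => -(((i : ℕ) : ℕ) : ZMod m)) (fun i : Fin (e + 1) => (((i : ℕ) + 1 : ℕ) : ZMod m)))) := by
  intro s s' h
  rcases s with j | i | i <;> rcases s' with j' | i' | i' <;>
    simp only [Sum.elim_inl, Sum.elim_inr] at h
  · -- free / free
    have := natCast_zmod_injOn (m := m) (by omega) (by omega) h
    exact congrArg _ (Fin.ext (by omega))
  · -- free / reflected : `e+2+j = -i'` ⇒ `e+2+j+i' ≡ 0`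
    exfalso
    have h2 : (((e + 2 + (j : ℕ) + (i' : ℕ) : ℕ)) : ZMod m) = 0 := by
      push_cast at h ⊢
      linear_combination h
    exact natCast_zmod_ne_zero (m := m) (by omega) (by omega) h2
  · -- free / direct
    exfalso
    have := natCast_zmod_injOn (m := m) (by omega) (by omega) h
    omega
  · -- reflected / free
    exfalso
    have h2 : (((e + 2 + (j' : ℕ) + (i : ℕ) : ℕ)) : ZMod m) = 0 := by
      push_cast at h ⊢
      linear_combination -h
    exact natCast_zmod_ne_zero (m := m) (by omega) (by omega) h2
  · -- reflected / reflected
    have h1 : (((i : ℕ) : ℕ) : ZMod m) = (((i' : ℕ) : ℕ) : ZMod m) := neg_injective h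
    have := natCast_zmod_injOn (m := m) (by omega) (by omega) h1
    exact congrArg _ (congrArg _ (Fin.ext this))
  · -- reflected / direct : `-i = i'+1` ⇒ `i + i' + 1 ≡ 0`
    exfalso
    have h2 : ((((i : ℕ) + ((i' : ℕ) + 1) : ℕ)) : ZMod m) = 0 := by
      push_cast at h ⊢
      linear_combination -h
    exact natCast_zmod_ne_zero (m := m) (by omega) (by omega) h2
  · -- direct / free
    exfalso
    have := natCast_zmod_injOn (m := m) (by omega) (by omega) h
    omega
  · -- direct / reflected
    exfalso
    have h2 : ((((i' : ℕ) + ((i : ℕ) + 1) : ℕ)) : ZMod m) = 0 := by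
      push_cast at h ⊢
      linear_combination h
    exact natCast_zmod_ne_zero (m := m) (by omega) (by omega) h2
  · -- direct / direct
    have := natCast_zmod_injOn (m := m) (by omega) (by omega) h
    exact congrArg _ (congrArg _ (Fin.ext (by omega)))

variable [NeZero m]

/-- The three groups exhaust the cycle: `Sum.elim free (Sum.elim reflected direct)` is a bijection onto `ℤ/mℤ`. -/
theorem bondGroups_bijective {n e : ℕ} (hm : m = n + 2 * e + 2) :
    Function.Bijective (Sum.elim (fun j : Fin n => ((e + 2 + (j : ℕ) : ℕ) : ZMod m))
      (Sum.elim (fun i : Fin (e + 1) => -(((i : ℕ) : ℕ) : ZMod m)) (fun i : Fin (e + 1) => (((i : ℕ) + 1 : ℕ) : ZMod m)))) := by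
  rw [Fintype.bijective_iff_injective_and_card]
  refine ⟨bondGroups_injective hm, ?_⟩
  simp only [Fintype.card_sum, Fintype.card_fin, ZMod.card]
  omega

end Index

/-! ## §2 ★★ The block factorisation -/

section BlockChain

variable {S : ℕ} [NeZero S] {G : Type} [Group G] {Nc : ℕ} (ρ : G →* Matrix (Fin Nc) (Fin Nc) ℂ)
variable [TopologicalSpace G] [IsTopologicalGroup G] [CompactSpace G] [MeasurableSpace G] [BorelSpace G]
  [SecondCountableTopology G]

omit [CompactSpace G] [MeasurableSpace G] [BorelSpace G] [SecondCountableTopology G] in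
/-- For fixed sites the open link is continuous in the bond half layer. -/
theorem continuous_openLink_right (hρ : Continuous ρ) (β M : ℝ) (a b : ℕ × HalfCfg S S G) :
    Continuous fun Y : HalfCfg S S G => openLink ρ β M a b Y := by
  have h := (continuous_openLink ρ hρ β M a.1 b.1).comp
    (continuous_const.prodMk (continuous_const.prodMk continuous_id) :
      Continuous fun Y : HalfCfg S S G => (a.2, b.2, Y))
  simpa only [Function.comp_def] using h

omit [CompactSpace G] in
/-- The half-block integrand at fixed sites is measurable in the bond half layers. -/
theorem measurable_halfBlock_integrand_right (hρ : Continuous ρ) (β M : ℝ) {e : ℕ}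
    {f : (Fin (e + 1) → HalfCfg S S G) → (Fin (e + 1) → HalfCfg S S G) → ℝ} (hf : Measurable (uncurry f))
    (v : Fin (e + 2) → ℕ × HalfCfg S S G) :
    Measurable fun Y : Fin (e + 1) → HalfCfg S S G =>
      (∏ i : Fin (e + 1), openLink ρ β M (v (Fin.castSucc i)) (v i.succ) (Y i)) * f Y (fun i => (v i.succ).2) := by
  refine (Finset.measurable_prod _ fun i _ => ?_).mul ?_
  · exact (continuous_openLink_right ρ hρ β M _ _).measurable.comp (measurable_pi_apply i)
  · exact hf.comp (measurable_id.prodMk measurable_const)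

/-- **The reflected half block**: substituting `Y ↦ ΘY` layer by layer (measure-preserving) and reversing every open link,
`∫ (∏_i openLink(v_{i+1}, v_i)(Y_i)) f(ΘY, X(v)) dY = halfBlock f v`. -/
theorem integral_prod_openLink_thetaHalf_eq_halfBlock (β M : ℝ) {e : ℕ}
    (f : (Fin (e + 1) → HalfCfg S S G) → (Fin (e + 1) → HalfCfg S S G) → ℝ)
    (v : Fin (e + 2) → ℕ × HalfCfg S S G) :
    ∫ Y : Fin (e + 1) → HalfCfg S S G, (∏ i : Fin (e + 1), openLink ρ β M (v i.succ) (v (Fin.castSucc i)) (Y i)) *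
        f (fun i => thetaHalf (Y i)) (fun i => (v i.succ).2) ∂(Measure.pi fun _ => halfHaar S G) =
      halfBlock ρ β M f v := by
  haveI : IsProbabilityMeasure (halfHaar S G) := by unfold halfHaar; infer_instance
  have hmp : MeasurePreserving (MeasurableEquiv.piCongrRight fun _ : Fin (e + 1) =>
      (thetaEquiv : HalfCfg S S G ≃ᵐ HalfCfg S S G))
      (Measure.pi fun _ : Fin (e + 1) => halfHaar S G) (Measure.pi fun _ : Fin (e + 1) => halfHaar S G) :=
    measurePreserving_pi _ _ fun _ => measurePreserving_thetaEquiv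
  unfold halfBlock
  rw [← hmp.integral_comp']
  refine integral_congr_ae (ae_of_all _ fun Y => ?_)
  simp only [MeasurableEquiv.piCongrRight, MeasurableEquiv.coe_mk, Equiv.piCongrRight_apply, MeasurableEquiv.coe_toEquiv,
    Pi.map_apply, thetaEquiv_apply, thetaHalf_thetaHalf, openLink_thetaHalf]

/-- ★★ **Block factorisation of the reflected two-point insertion** (`β ≥ 0`, `ρ` continuous unitary, `|w(Y)_j| ≤ M`, chain length
`m = n + 2e + 2`, observable `f` of depth `e + 1`, bounded and measurable):
`∫ Θf(P) · f(P) · ∏_t e^{β even_t} e^{β odd_t} dP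
 = ∫ (∏_{j<n} 𝔟(V_{e+1+j}, V_{e+2+j})) · (halfBlock f (j ↦ V_{-j}) · halfBlock f (j ↦ V_j)) dμ̃^{⊗ℤ/mℤ}(V)`. -/
theorem integral_obsLR_mul_pairChain_eq (hρ : Continuous ρ) {β : ℝ} (hβ : 0 ≤ β)
    (hρu : ∀ g, ρ g ∈ Matrix.unitaryGroup (Fin Nc) ℂ) {M : ℝ}
    (hM : ∀ (Y : HalfCfg S S G) (j : Fin (featDim S Nc)), |bondVec ρ Y j| ≤ M) {m n e : ℕ} [NeZero m]
    (hm : m = n + 2 * e + 2) {f : (Fin (e + 1) → HalfCfg S S G) → (Fin (e + 1) → HalfCfg S S G) → ℝ}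
    (hf : Measurable (uncurry f)) {B : ℝ} (hB : ∀ Y X, |f Y X| ≤ B) :
    ∫ P : ZMod m → HalfCfg S S G × HalfCfg S S G,
        obsL f P * obsR f P * ∏ t : ZMod m, Real.exp (β * evenActionU ρ (P t).1 (P t).2 (P (t + 1)).1) *
          Real.exp (β * oddActionU ρ (P t).2 (P (t + 1)).1 (P (t + 1)).2)
        ∂(Measure.pi fun _ : ZMod m => (halfHaar S G).prod (halfHaar S G)) =
      ∫ V : ZMod m → ℕ × HalfCfg S S G,
        (∏ j : Fin n, bKernel ρ β M (V ((e + 1 + (j : ℕ) : ℕ) : ZMod m)) (V ((e + 2 + (j : ℕ) : ℕ) : ZMod m))) *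
          (halfBlock ρ β M f (fun j : Fin (e + 2) => V (-(((j : ℕ) : ℕ) : ZMod m))) *
            halfBlock ρ β M f (fun j : Fin (e + 2) => V (((j : ℕ) : ℕ) : ZMod m)))
        ∂(Measure.pi fun _ => tMeasure S G Nc β M) := by
  haveI : IsProbabilityMeasure (halfHaar S G) := by unfold halfHaar; infer_instance
  -- the observable `Θf · f` is bounded and measurable
  have hB0 : 0 ≤ B := (abs_nonneg _).trans (hB (fun _ _ => 1) (fun _ _ => 1))
  have hΩm : Measurable fun P : ZMod m → HalfCfg S S G × HalfCfg S S G => obsL f P * obsR f P := by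
    refine Measurable.mul ?_ ?_
    · unfold obsL
      exact hf.comp ((measurable_pi_lambda _ fun i => (continuous_thetaHalf.measurable.comp
        (measurable_fst.comp (measurable_pi_apply _)))).prodMk
        (measurable_pi_lambda _ fun i => measurable_snd.comp (measurable_pi_apply _)))
    · unfold obsR
      exact hf.comp ((measurable_pi_lambda _ fun i => measurable_fst.comp (measurable_pi_apply _)).prodMk
        (measurable_pi_lambda _ fun i => measurable_snd.comp (measurable_pi_apply _)))
  have hΩb : ∀ P : ZMod m → HalfCfg S S G × HalfCfg S S G, |obsL f P * obsR f P| ≤ B * B := fun P => by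
    rw [abs_mul]; exact mul_le_mul (hB _ _) (hB _ _) (abs_nonneg _) hB0
  rw [integral_obs_mul_pairChain_eq ρ hρ hβ hρu hM hΩm hΩb]
  refine integral_congr_ae (ae_of_all _ fun V => ?_)
  dsimp only
  -- notation for the three index maps and the open links along the cycle
  set σF : Fin n → ZMod m := fun j => ((e + 2 + (j : ℕ) : ℕ) : ZMod m) with hσF
  set σL : Fin (e + 1) → ZMod m := fun i => -(((i : ℕ) : ℕ) : ZMod m) with hσL
  set σR : Fin (e + 1) → ZMod m := fun i => (((i : ℕ) + 1 : ℕ) : ZMod m) with hσR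
  set g : ZMod m → HalfCfg S S G → ℝ := fun t y => openLink ρ β M (V (t - 1)) (V t) y with hg
  have hgm : ∀ t, Measurable (g t) := fun t => (continuous_openLink_right ρ hρ β M _ _).measurable
  have hbij := bondGroups_bijective (m := m) hm
  set ε : Fin n ⊕ (Fin (e + 1) ⊕ Fin (e + 1)) ≃ ZMod m := Equiv.ofBijective _ hbij with hε
  -- the three-group split of the cyclic product of open links
  have hprod : ∀ Y : ZMod m → HalfCfg S S G, ∏ t, g t (Y t) =
      (∏ j, g (σF j) (Y (σF j))) * ((∏ i, g (σL i) (Y (σL i))) * ∏ i, g (σR i) (Y (σR i))) := by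
    intro Y
    rw [← Fintype.prod_equiv ε (fun s => g (ε s) (Y (ε s))) (fun t => g t (Y t)) (fun s => rfl),
      Fintype.prod_sum_type, Fintype.prod_sum_type]
    rfl
  -- the three integrands
  set AF : (Fin n → HalfCfg S S G) → ℝ := fun y => ∏ j, g (σF j) (y j) with hAF
  set AL : (Fin (e + 1) → HalfCfg S S G) → ℝ := fun y =>
    (∏ i, g (σL i) (y i)) * f (fun i => thetaHalf (y i)) (fun i => (V (-((((i : ℕ) + 1 : ℕ)) : ZMod m))).2) with hAL
  set AR : (Fin (e + 1) → HalfCfg S S G) → ℝ := fun y =>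
    (∏ i, g (σR i) (y i)) * f y (fun i => (V ((((i : ℕ) + 1 : ℕ)) : ZMod m)).2) with hAR
  set C : (Fin (e + 1) ⊕ Fin (e + 1) → HalfCfg S S G) → ℝ := fun z =>
    AL (fun i => z (Sum.inl i)) * AR (fun i => z (Sum.inr i)) with hC
  have hAFm : Measurable AF := Finset.measurable_prod _ fun j _ => (hgm _).comp (measurable_pi_apply j)
  have hALm : Measurable AL := by
    refine (Finset.measurable_prod _ fun i _ => (hgm _).comp (measurable_pi_apply i)).mul ?_
    exact hf.comp ((measurable_pi_lambda _ fun i => continuous_thetaHalf.measurable.comp (measurable_pi_apply i)).prodMk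
      measurable_const)
  have hARm : Measurable AR :=
    (Finset.measurable_prod _ fun i _ => (hgm _).comp (measurable_pi_apply i)).mul (hf.comp (measurable_id.prodMk measurable_const))
  have hCm : Measurable C :=
    (hALm.comp (measurable_pi_lambda _ fun i => measurable_pi_apply _)).mul
      (hARm.comp (measurable_pi_lambda _ fun i => measurable_pi_apply _))
  -- rewrite the integrand as `AF(Y∘σF) · C(Y∘σLR)`
  have hint : ∀ Y : ZMod m → HalfCfg S S G,
      (∏ t, openLink ρ β M (V (t - 1)) (V t) (Y t)) * (obsL f (fun t => (Y t, (V t).2)) * obsR f (fun t => (Y t, (V t).2))) =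
        AF (fun j => Y (σF j)) * C (fun s => Y (Sum.elim σL σR s)) := by
    intro Y
    have h1 : (∏ t, openLink ρ β M (V (t - 1)) (V t) (Y t)) = ∏ t, g t (Y t) := rfl
    rw [h1, hprod Y]
    simp only [hAF, hC, hAL, hAR, obsL, obsR, Sum.elim_inl, Sum.elim_inr, hσL, hσR]
    ring
  simp_rw [hint]
  -- independence of the free group from the two block groups
  have hσF_inj : Function.Injective σF := fun j j' h => Sum.inl_injective (hbij.1 (a₁ := Sum.inl j) (a₂ := Sum.inl j') h)
  have hσLR_inj : Function.Injective (Sum.elim σL σR) := fun s s' h =>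
    Sum.inr_injective (hbij.1 (a₁ := Sum.inr s) (a₂ := Sum.inr s') h)
  have hdisj : ∀ j s, σF j ≠ Sum.elim σL σR s := fun j s h =>
    Sum.inl_ne_inr (hbij.1 (a₁ := Sum.inl j) (a₂ := Sum.inr s) h)
  rw [integral_proj_mul_proj (halfHaar S G) hσF_inj hσLR_inj hdisj hAFm hCm]
  -- independence of the two block groups
  have hC2 : ∫ z, C z ∂(Measure.pi fun _ : Fin (e + 1) ⊕ Fin (e + 1) => halfHaar S G) =
      (∫ y, AL y ∂(Measure.pi fun _ : Fin (e + 1) => halfHaar S G)) * ∫ y, AR y ∂(Measure.pi fun _ : Fin (e + 1) => halfHaar S G) := by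
    simp only [hC]
    exact integral_proj_mul_proj (halfHaar S G) (ι := Fin (e + 1) ⊕ Fin (e + 1)) Sum.inl_injective Sum.inr_injective
      (fun _ _ => Sum.inl_ne_inr) hALm hARm
  rw [hC2]
  -- the free factor: `n` reweighted lifted kernels
  have hF : ∫ y, AF y ∂(Measure.pi fun _ : Fin n => halfHaar S G) =
      ∏ j : Fin n, bKernel ρ β M (V ((e + 1 + (j : ℕ) : ℕ) : ZMod m)) (V ((e + 2 + (j : ℕ) : ℕ) : ZMod m)) := by
    simp only [hAF]
    rw [integral_fintype_prod_eq_prod]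
    refine Finset.prod_congr rfl fun j _ => ?_
    simp only [hg, hσF]
    rw [integral_openLink]
    congr 2
    push_cast
    ring
  -- the direct half block
  have hR : ∫ y, AR y ∂(Measure.pi fun _ : Fin (e + 1) => halfHaar S G) =
      halfBlock ρ β M f (fun j : Fin (e + 2) => V (((j : ℕ) : ℕ) : ZMod m)) := by
    simp only [hAR, hg, hσR]
    unfold halfBlock
    refine integral_congr_ae (ae_of_all _ fun y => ?_)
    have hidx : ∀ i : Fin (e + 1), ((((i : ℕ) + 1 : ℕ) : ZMod m)) = (((i.succ : Fin (e + 2)) : ℕ) : ZMod m) := fun i => by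
      rw [Fin.val_succ]
    have hidx' : ∀ i : Fin (e + 1), (((i.succ : Fin (e + 2)) : ℕ) : ZMod m) - 1 = (((i : ℕ) : ℕ) : ZMod m) := fun i => by
      rw [Fin.val_succ]; push_cast; ring
    simp only [hidx]
    simp only [hidx', Fin.val_castSucc]
  -- the reflected half block
  have hL : ∫ y, AL y ∂(Measure.pi fun _ : Fin (e + 1) => halfHaar S G) =
      halfBlock ρ β M f (fun j : Fin (e + 2) => V (-(((j : ℕ) : ℕ) : ZMod m))) := by
    simp only [hAL, hg, hσL]
    rw [← integral_prod_openLink_thetaHalf_eq_halfBlock ρ β M f]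
    refine integral_congr_ae (ae_of_all _ fun y => ?_)
    have hidx : ∀ i : Fin (e + 1), -(((i : ℕ) : ℕ) : ZMod m) - 1 = -(((i.succ : Fin (e + 2)) : ℕ) : ZMod m) := fun i => by
      rw [Fin.val_succ]; push_cast; ring
    have hidx'' : ∀ i : Fin (e + 1), -((((i : ℕ) + 1 : ℕ)) : ZMod m) = -(((i.succ : Fin (e + 2)) : ℕ) : ZMod m) := fun i => by
      rw [Fin.val_succ]
    simp only [hidx, hidx'', Fin.val_castSucc]
  rw [hF, hL, hR]

end BlockChain

end Summit.QuantumFields.YangMills.Cruxes.DiagonalMirrorRPR.SignTwistedDiagonalTrace.WilsonDiagonal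

end
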